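import Literature.NumberTheory.GaloisRepresentations.LocalReciprocityNormFunctoriality
import Literature.NumberTheory.GaloisRepresentations.AbstractReciprocityConjProofs
import HarnessLib

/-!
# Conjugation-equivariance of the reciprocity system of a finite Galois extension read in the
# Weil datum (Neukirch, *Algebraic Number Theory* IV (5.8): transport of structure), theorems only

Let `F` be a non-archimedean local field and `E/F` a finite normal separable extension, read inside
`F̄` as `E₀ = ι⁻¹(E)` (`embField F E`, `ι = absClosureEmbedding F E : F̄ ≅ Ē`) with Weil subgroup
`U_E = W_F ∩ G_{E₀}` (`fieldSubgroup F (embField F E)`), as in `LocalWeilDatumExtension*` and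
`LocalReciprocityNormFunctoriality` (the reciprocity system `recSystemE` of `E` read in the Weil datum
of `F`).  An element `g ∈ Γ_F` (in particular `ρ̂` for `ρ ∈ W_F`) acts

* on `Ē` by the ring automorphism `φ_g = ι g ι⁻¹`, which is `γ`-SEMILINEAR over `E` for
  `γ = g|_E ∈ Aut(E/F)` (`exists_ringEquiv_conj_absClosureEmbedding`, `exists_ringEquiv_semilinear`;
  normality of `E/F`);
* on `Γ_E ≅ G_{E₀}` by conjugation (`res σ' = g · res σ · g⁻¹ ⟹ σ' ∘ φ_g = φ_g ∘ σ`,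
  `smul_map_of_absGaloisRestrict_eq_conj`);
* on the finite abelian `L' ⊆ Ē` over `E` by `L' ↦ φ_g L'` (§1: the image is again finite abelian
  over `E` — transport along the PAIR of isomorphisms `(γ, φ_g|_{L'})`, Mathlib
  `IsGalois.of_equiv_equiv`, `Module.Finite.of_equiv_equiv`);
* on the datum: `ρ U_E ρ⁻¹ = U_E`, `W_F ∩ G_{ι⁻¹ φL'} = ρ (W_F ∩ G_{ι⁻¹ L'}) ρ⁻¹`, `ρ • ι⁻¹x = ι⁻¹(γ x)`
  (§3).

The main result `recSystemE_semilinearImage` is Neukirch's functoriality IV (5.8) of the norm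
residue symbol under `σ : L|K → σL|σK`, for the inner `σ = ρ ∈ W_F`, obtained from the
conjugation-equivariance of the abstract reciprocity map inside ONE Weil datum
(`AbstractCFT.WeilDatum.IsClassFieldTheory.recMap_conjSub`, file `AbstractReciprocityConjProofs`):
`(x, L'/E) = w|_{L'} ⟹ (γ x, φL'/E) = (ρ w ρ⁻¹)|_{φL'}`.  The passage to `θ_E` and to the
`ℚ_p`-binder statement `mlf_reciprocity_equivariant` of the abc-iut cell ([AbsAnab] Prop 1.2.1) is
in `Literature/AnabelianGeometry/AbsoluteAnabelian/MLFReciprocityEquivariantProofs.lean`.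

No definitions, no named facts.  References: J. Neukirch, *Algebraic Number Theory* (1999), Ch. IV
§5 Prop. (5.8), §6 (6.4) [NeukirchANT1999]; J. Tate, *Number theoretic background* (Corvallis 1979),
(1.4.5) [TateCorvallis1979].
-/

noncomputable section

open Field IsNonarchimedeanLocalField ValuativeRel
open scoped Pointwise

namespace Literature.NumberTheory.GaloisRepresentations

namespace LocalWeilDatum

open AbstractCFT AbstractCFT.WeilDatum

/-! ### §1 Semilinear images of intermediate fields of `Ē/E` -/

section Semilinear

variable {E : Type*} [Field E]

/-- The image of an intermediate field `L' ⊆ Ē` under a ring automorphism `φ` of `Ē` which is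
`γ`-semilinear over `E` (`φ ∘ algebraMap = algebraMap ∘ γ`) is again an intermediate field of
`Ē/E` (existence form). [cite: NeukirchANT1999, Ch. IV Prop. (5.8)] -/
theorem exists_intermediateField_semilinearImage {γ : E ≃+* E}
    {φ : AlgebraicClosure E ≃+* AlgebraicClosure E}
    (hφ : ∀ x : E, φ (algebraMap E (AlgebraicClosure E) x) = algebraMap E (AlgebraicClosure E) (γ x))
    (L' : IntermediateField E (AlgebraicClosure E)) :
    ∃ M : IntermediateField E (AlgebraicClosure E), ∀ z, z ∈ M ↔ φ.symm z ∈ L' := by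
  refine ⟨(L'.toSubfield.map φ.toRingHom).toIntermediateField fun x => ?_, fun z => ?_⟩
  · refine ⟨algebraMap E (AlgebraicClosure E) (γ.symm x), L'.algebraMap_mem _, ?_⟩
    change φ (algebraMap E (AlgebraicClosure E) (γ.symm x)) = _
    rw [hφ, RingEquiv.apply_symm_apply]
  · change z ∈ L'.toSubfield.map φ.toRingHom ↔ _
    rw [Subfield.mem_map]
    constructor
    · rintro ⟨y, hy, rfl⟩
      change φ.symm (φ y) ∈ L'
      rw [RingEquiv.symm_apply_apply]
      exact hy
    · intro h
      exact ⟨φ.symm z, h, φ.apply_symm_apply z⟩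

variable {γ : E ≃+* E} {φ : AlgebraicClosure E ≃+* AlgebraicClosure E}
  (hφ : ∀ x : E, φ (algebraMap E (AlgebraicClosure E) x) = algebraMap E (AlgebraicClosure E) (γ x))
  {L' M : IntermediateField E (AlgebraicClosure E)} (hM : ∀ z, z ∈ M ↔ φ.symm z ∈ L')

include hM in
/-- `φ y ∈ φ L'` for `y ∈ L'`. [folklore] -/
private theorem map_mem_semilinearImage {y : AlgebraicClosure E} (hy : y ∈ L') : φ y ∈ M := by
  rw [hM, RingEquiv.symm_apply_apply]
  exact hy

include hM in
/-- The ring isomorphism `L' ≃+* φ L'` induced by `φ`, compatible with `γ` on `E` (existence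
form). [cite: NeukirchANT1999, Ch. IV Prop. (5.8)] -/
theorem exists_ringEquiv_semilinearImage :
    ∃ g : L' ≃+* M, (∀ y : L', ((g y : M) : AlgebraicClosure E) = φ y) ∧
      ((∀ x : E, φ (algebraMap E (AlgebraicClosure E) x) = algebraMap E (AlgebraicClosure E) (γ x)) →
        (algebraMap E M).comp (γ : E →+* E) = (g : L' →+* M).comp (algebraMap E L')) := by
  refine ⟨{ toFun := fun y => ⟨φ y, map_mem_semilinearImage hM y.2⟩
            invFun := fun z => ⟨φ.symm z, (hM z).mp z.2⟩
            left_inv := fun y => Subtype.ext (φ.symm_apply_apply (y : AlgebraicClosure E))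
            right_inv := fun z => Subtype.ext (φ.apply_symm_apply (z : AlgebraicClosure E))
            map_mul' := fun y y' => Subtype.ext (map_mul φ (y : AlgebraicClosure E) y')
            map_add' := fun y y' => Subtype.ext (map_add φ (y : AlgebraicClosure E) y') },
    fun _ => rfl, fun hφ => ?_⟩
  ext x
  change algebraMap E (AlgebraicClosure E) (γ x) = φ (algebraMap E (AlgebraicClosure E) x)
  rw [hφ]

include hφ hM in
/-- `φ L'` is finite over `E` when `L'` is (transport along the pair `(γ, φ)`). [cite: NeukirchANT1999, Ch. IV Prop. (5.8)] -/
theorem finiteDimensional_semilinearImage [FiniteDimensional E L'] : FiniteDimensional E M := by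
  obtain ⟨g, -, hg⟩ := exists_ringEquiv_semilinearImage hM
  exact Module.Finite.of_equiv_equiv γ g (hg hφ)

include hφ hM in
/-- `φ L'` is Galois over `E` when `L'` is (transport along the pair `(γ, φ)`,
`IsGalois.of_equiv_equiv`). [cite: NeukirchANT1999, Ch. IV Prop. (5.8)] -/
theorem isGalois_semilinearImage [IsGalois E L'] : IsGalois E M := by
  obtain ⟨g, -, hg⟩ := exists_ringEquiv_semilinearImage hM
  exact IsGalois.of_equiv_equiv (F := E) (E := L') (f := γ) (g := g) (hg hφ)

include hφ hM in
/-- `φ L'` is abelian over `E` when `L'` is: `τ ↦ φ⁻¹ ∘ τ ∘ φ` embeds `Gal(φL'/E)` into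
`Gal(L'/E)` multiplicatively. [cite: NeukirchANT1999, Ch. IV Prop. (5.8)] -/
theorem isAbelianGalois_semilinearImage [IsAbelianGalois E L'] : IsAbelianGalois E M := by
  haveI := isGalois_semilinearImage hφ hM
  obtain ⟨g, -, hg'⟩ := exists_ringEquiv_semilinearImage hM
  have hg : ∀ x : E, g (algebraMap E L' x) = algebraMap E M (γ x) := fun x =>
    (RingHom.congr_fun (hg' hφ) x).symm
  -- pull back an `E`-automorphism of `M` to one of `L'`
  let pull : (M ≃ₐ[E] M) → (L' ≃ₐ[E] L') := fun τ =>
    { (g.trans ((τ : M ≃+* M).trans g.symm) : L' ≃+* L') with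
      commutes' := fun x => by
        change g.symm (τ (g (algebraMap E L' x))) = algebraMap E L' x
        rw [hg, AlgEquiv.commutes, ← hg, RingEquiv.symm_apply_apply] }
  have hpull : ∀ τ (y : L'), (pull τ y : L') = g.symm (τ (g y)) := fun _ _ => rfl
  have hinj : Function.Injective pull := by
    intro τ₁ τ₂ h
    ext z
    have := congrArg (fun t : L' ≃ₐ[E] L' => (g (t (g.symm z)) : AlgebraicClosure E)) h
    simpa [hpull] using this
  have hmul : ∀ τ₁ τ₂, pull (τ₁ * τ₂) = pull τ₁ * pull τ₂ := by
    intro τ₁ τ₂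
    ext y
    simp only [AlgEquiv.mul_apply, hpull, RingEquiv.apply_symm_apply]
  haveI : IsMulCommutative (M ≃ₐ[E] M) :=
    ⟨⟨fun τ₁ τ₂ => hinj (by rw [hmul, hmul]; exact IsMulCommutative.is_comm.comm _ _)⟩⟩
  exact { toIsGalois := inferInstance, toIsMulCommutative := inferInstance }

/-- Restriction to `L'` determines restriction of the `φ`-conjugates to `φ L'`: if `σ`, `τ` agree
on `L'` and `σ' ∘ φ = φ ∘ σ`, `τ' ∘ φ = φ ∘ τ`, then `σ'`, `τ'` agree on `φ L'`. [cite: NeukirchANT1999, Ch. IV Prop. (5.8)] -/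
theorem restrictNormalHom_eq_of_semilinear_conj (hM : ∀ z, z ∈ M ↔ φ.symm z ∈ L')
    [Normal E L'] [Normal E M]
    {σ τ σ' τ' : absoluteGaloisGroup E}
    (hσ' : ∀ z, σ' • φ z = φ (σ • z)) (hτ' : ∀ z, τ' • φ z = φ (τ • z))
    (h : AlgEquiv.restrictNormalHom L' (absoluteGaloisGroup.toAlgEquiv E σ) =
      AlgEquiv.restrictNormalHom L' (absoluteGaloisGroup.toAlgEquiv E τ)) :
    AlgEquiv.restrictNormalHom M (absoluteGaloisGroup.toAlgEquiv E σ') =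
      AlgEquiv.restrictNormalHom M (absoluteGaloisGroup.toAlgEquiv E τ') := by
  ext z
  have hz : φ.symm (z : AlgebraicClosure E) ∈ L' := (hM z).mp z.2
  have h1 := congrArg (fun t : L' ≃ₐ[E] L' => ((t ⟨_, hz⟩ : L') : AlgebraicClosure E)) h
  simp only [AlgEquiv.restrictNormalHom_apply] at h1 ⊢
  rw [← absoluteGaloisGroup.smul_def, ← absoluteGaloisGroup.smul_def] at h1 ⊢
  change σ • φ.symm z = τ • φ.symm z at h1
  conv_lhs => rw [← φ.apply_symm_apply (z : AlgebraicClosure E), hσ', h1, ← hτ', φ.apply_symm_apply]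

end Semilinear

/-! ### §2 Conjugation data attached to `g ∈ Γ_F` for `E/F` finite normal -/

section ConjData

variable (F E : Type*) [Field F] [Field E] [Algebra F E] [Algebra.IsAlgebraic F E]

omit [Algebra.IsAlgebraic F E] in
/-- `E₀ = ι⁻¹(E) ⊆ F̄` is normal over `F` when `E/F` is. [cite: NeukirchANT1999, Ch. IV Prop. (5.8)] -/
theorem normal_embField [Normal F E] : Normal F (embField F E) :=
  Normal.of_algEquiv (equivEmbField F E)

omit [Algebra.IsAlgebraic F E] in
/-- `Γ_F` preserves the normal subextension `E₀ ⊆ F̄`. [cite: NeukirchANT1999, Ch. IV Prop. (5.8)] -/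
theorem smul_mem_embField [Normal F E] (g : absoluteGaloisGroup F) {a : AlgebraicClosure F}
    (ha : a ∈ embField F E) : g • a ∈ embField F E := by
  haveI := normal_embField F E
  have h := AlgEquiv.restrictNormal_commutes (absoluteGaloisGroup.toAlgEquiv F g) (embField F E) ⟨a, ha⟩
  rw [absoluteGaloisGroup.smul_def]
  change (absoluteGaloisGroup.toAlgEquiv F g)
    (algebraMap (embField F E) (AlgebraicClosure F) ⟨a, ha⟩) ∈ embField F E
  rw [← h]
  exact SetLike.coe_mem _

omit [Algebra.IsAlgebraic F E] in
/-- `G_{E₀} ⊴ Γ_F` for `E/F` normal: `g G_{E₀} g⁻¹ ⊆ G_{E₀}`. [cite: NeukirchANT1999, Ch. IV Prop. (5.8)] -/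
theorem conj_mem_galFixing [Normal F E] (g : absoluteGaloisGroup F) {h : absoluteGaloisGroup F}
    (hh : h ∈ galFixing F (embField F E)) : g * h * g⁻¹ ∈ galFixing F (embField F E) := by
  rw [mem_galFixing_iff] at hh ⊢
  intro a ha
  rw [mul_smul, mul_smul, hh _ (smul_mem_embField F E g⁻¹ ha), smul_inv_smul]

/-- The ring automorphism `φ_g = ι ∘ g ∘ ι⁻¹` of `Ē` attached to `g ∈ Γ_F` (existence form;
`ι = absClosureEmbedding F E : F̄ ≅ Ē`). [cite: TateCorvallis1979, (1.4.5)] -/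
theorem exists_ringEquiv_conj_absClosureEmbedding (g : absoluteGaloisGroup F) :
    ∃ φ : AlgebraicClosure E ≃+* AlgebraicClosure E,
      ∀ a, φ (absClosureEmbedding F E a) = absClosureEmbedding F E (g • a) := by
  refine ⟨((absClosureEquiv F E).symm.trans
    ((absoluteGaloisGroup.toAlgEquiv F g).trans (absClosureEquiv F E))).toRingEquiv, fun a => ?_⟩
  change absClosureEquiv F E (absoluteGaloisGroup.toAlgEquiv F g
    ((absClosureEquiv F E).symm (absClosureEmbedding F E a))) = _
  rw [absClosureEquiv_symm_absClosureEmbedding, absClosureEquiv_apply, absoluteGaloisGroup.smul_def]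

omit [Algebra.IsAlgebraic F E] in
/-- `φ_g⁻¹ (ι b) = ι (g⁻¹ • b)`. [folklore] -/
private theorem symm_absClosureEmbedding_of_conj {g : absoluteGaloisGroup F}
    {φ : AlgebraicClosure E ≃+* AlgebraicClosure E}
    (hφι : ∀ a, φ (absClosureEmbedding F E a) = absClosureEmbedding F E (g • a))
    (b : AlgebraicClosure F) :
    φ.symm (absClosureEmbedding F E b) = absClosureEmbedding F E (g⁻¹ • b) := by
  rw [RingEquiv.symm_apply_eq, hφι, smul_inv_smul]

omit [Algebra.IsAlgebraic F E] in
/-- `φ_g` is `γ`-semilinear over `E` for the automorphism `γ = g|_E` of `E` (`E/F` normal):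
existence of `γ` with `φ_g ∘ algebraMap = algebraMap ∘ γ`. [cite: NeukirchANT1999, Ch. IV Prop. (5.8)] -/
theorem exists_ringEquiv_semilinear [Normal F E] {g : absoluteGaloisGroup F}
    {φ : AlgebraicClosure E ≃+* AlgebraicClosure E}
    (hφι : ∀ a, φ (absClosureEmbedding F E a) = absClosureEmbedding F E (g • a)) :
    ∃ γ : E ≃+* E, ∀ x : E,
      φ (algebraMap E (AlgebraicClosure E) x) = algebraMap E (AlgebraicClosure E) (γ x) := by
  haveI := normal_embField F E
  let ρ : embField F E ≃ₐ[F] embField F E :=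
    (absoluteGaloisGroup.toAlgEquiv F g).restrictNormal (embField F E)
  refine ⟨((equivEmbField F E).trans (ρ.trans (equivEmbField F E).symm)).toRingEquiv, fun x => ?_⟩
  have h1 : ((ρ (equivEmbField F E x) : embField F E) : AlgebraicClosure F) =
      g • ((equivEmbField F E x : embField F E) : AlgebraicClosure F) := by
    rw [absoluteGaloisGroup.smul_def]
    exact AlgEquiv.restrictNormal_commutes (absoluteGaloisGroup.toAlgEquiv F g) (embField F E)
      (equivEmbField F E x)
  change φ (algebraMap E (AlgebraicClosure E) x) =
    algebraMap E (AlgebraicClosure E) ((equivEmbField F E).symm (ρ (equivEmbField F E x)))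
  rw [← absClosureEmbedding_coe_eq, h1, ← hφι, absClosureEmbedding_equivEmbField]

/-- **Conjugation by `g` read on `Ē`**: if `res σ' = g · res σ · g⁻¹` in `Γ_F`, then
`σ' ∘ φ_g = φ_g ∘ σ` on `Ē`. [cite: TateCorvallis1979, (1.4.5)] -/
theorem smul_map_of_absGaloisRestrict_eq_conj {g : absoluteGaloisGroup F}
    {φ : AlgebraicClosure E ≃+* AlgebraicClosure E}
    (hφι : ∀ a, φ (absClosureEmbedding F E a) = absClosureEmbedding F E (g • a))
    {σ σ' : absoluteGaloisGroup E}
    (hσ' : absGaloisRestrict F E σ' = g * absGaloisRestrict F E σ * g⁻¹) (z : AlgebraicClosure E) :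
    σ' • φ z = φ (σ • z) := by
  obtain ⟨a, rfl⟩ := (absClosureEmbedding_bijective F E).2 z
  rw [hφι, ← absGaloisRestrict_apply_smul, hσ', mul_smul, mul_smul, inv_smul_smul, ← hφι,
    absGaloisRestrict_apply_smul]

/-- `res (liftGal (g h g⁻¹)) = g · res (liftGal h) · g⁻¹`. [cite: TateCorvallis1979, (1.4.5)] -/
theorem absGaloisRestrict_liftGal_conj (g : absoluteGaloisGroup F)
    {h : absoluteGaloisGroup F} (hh : h ∈ galFixing F (embField F E))
    (hh' : g * h * g⁻¹ ∈ galFixing F (embField F E)) :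
    absGaloisRestrict F E (liftGal F E hh') = g * absGaloisRestrict F E (liftGal F E hh) * g⁻¹ := by
  rw [absGaloisRestrict_liftGal, absGaloisRestrict_liftGal]

end ConjData

/-! ### §3 The datum side: conjugation by `ρ ∈ W_F` -/

section Datum

variable (F E : Type*) [Field F] [ValuativeRel F] [TopologicalSpace F] [IsNonarchimedeanLocalField F]
  [Field E] [Algebra F E] [FiniteDimensional F E] [Algebra.IsSeparable F E] [Normal F E]

omit [FiniteDimensional F E] [Algebra.IsSeparable F E] in
/-- `ρ U_E ρ⁻¹ = U_E` for `U_E = W_F ∩ G_{E₀}`, `E/F` normal. [cite: NeukirchANT1999, Ch. IV Prop. (5.8)] -/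
theorem conjSub_fieldSubgroup_embField (ρ : WeilGroup F) :
    conjSub ρ (fieldSubgroup F (embField F E)) = fieldSubgroup F (embField F E) := by
  ext τ
  rw [mem_conjSub_iff, fieldSubgroup, Subgroup.mem_comap, Subgroup.mem_comap, map_mul, map_mul,
    map_inv]
  constructor
  · intro h
    have h' := conj_mem_galFixing F E (WeilGroup.toAbsGalois F ρ) h
    have e : WeilGroup.toAbsGalois F ρ * ((WeilGroup.toAbsGalois F ρ)⁻¹ * WeilGroup.toAbsGalois F τ *
        WeilGroup.toAbsGalois F ρ) * (WeilGroup.toAbsGalois F ρ)⁻¹ = WeilGroup.toAbsGalois F τ := by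
      group
    rwa [e] at h'
  · intro h
    have h' := conj_mem_galFixing F E (WeilGroup.toAbsGalois F ρ)⁻¹ h
    rwa [inv_inv] at h'

omit [FiniteDimensional F E] [Algebra.IsSeparable F E] in
/-- `ρ w ρ⁻¹ ∈ U_E` for `w ∈ U_E`. [folklore] -/
private theorem conj_mem_fieldSubgroup_embField (ρ : WeilGroup F) (w : fieldSubgroup F (embField F E)) :
    ρ * w * ρ⁻¹ ∈ fieldSubgroup F (embField F E) :=
  (conjSub_fieldSubgroup_embField F E ρ).le (conj_mem_conjSub_iff.mpr w.2)

variable {F E}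

omit [FiniteDimensional F E] [Algebra.IsSeparable F E] [Normal F E] in
/-- `W_F ∩ G_{ι⁻¹(φ_ρ L')} = ρ (W_F ∩ G_{ι⁻¹ L'}) ρ⁻¹`: the Weil subgroup of the image of `L'`
under `φ_ρ = ι ρ ι⁻¹` is the conjugate Weil subgroup. [cite: NeukirchANT1999, Ch. IV Prop. (5.8)] -/
theorem fieldSubgroup_embFieldOf_semilinearImage (ρ : WeilGroup F)
    {φ : AlgebraicClosure E ≃+* AlgebraicClosure E}
    (hφι : ∀ a, φ (absClosureEmbedding F E a) = absClosureEmbedding F E (WeilGroup.toAbsGalois F ρ • a))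
    {L' M : IntermediateField E (AlgebraicClosure E)} (hM : ∀ z, z ∈ M ↔ φ.symm z ∈ L') :
    fieldSubgroup F (embFieldOf F E M) = conjSub ρ (fieldSubgroup F (embFieldOf F E L')) := by
  have key : ∀ b, absClosureEmbedding F E b ∈ M ↔
      absClosureEmbedding F E ((WeilGroup.toAbsGalois F ρ)⁻¹ • b) ∈ L' := fun b => by
    rw [hM, symm_absClosureEmbedding_of_conj F E hφι]
  ext τ
  rw [mem_conjSub_iff, mem_fieldSubgroup_iff, mem_fieldSubgroup_iff]
  simp only [mem_embFieldOf_iff, map_mul, map_inv]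
  constructor
  · intro h a ha
    have hb : absClosureEmbedding F E (WeilGroup.toAbsGalois F ρ • a) ∈ M := by
      rw [key, inv_smul_smul]
      exact ha
    rw [mul_smul, mul_smul, h _ hb, inv_smul_smul]
  · intro h b hb
    have h1 := h _ ((key b).mp hb)
    rw [mul_smul, mul_smul, smul_inv_smul] at h1
    exact smul_left_cancel _ h1

omit [Normal F E] in
/-- `ρ • ι⁻¹ x = ι⁻¹ (γ x)` in `A = (F^sep)ˣ`, for `φ_ρ` `γ`-semilinear. [cite: NeukirchANT1999, Ch. IV Prop. (5.8)] -/
theorem smul_unitE (ρ : WeilGroup F) {φ : AlgebraicClosure E ≃+* AlgebraicClosure E}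
    (hφι : ∀ a, φ (absClosureEmbedding F E a) = absClosureEmbedding F E (WeilGroup.toAbsGalois F ρ • a))
    {γ : E ≃+* E}
    (hφ : ∀ x : E, φ (algebraMap E (AlgebraicClosure E) x) = algebraMap E (AlgebraicClosure E) (γ x))
    (x : Eˣ) : ρ • unitE F E x = unitE F E (Units.map (γ : E →* E) x) := by
  apply Units.ext
  apply Subtype.ext
  apply (absClosureEmbedding_bijective F E).1
  rw [coe_smul, ← hφι, absClosureEmbedding_coe_unitE, absClosureEmbedding_coe_unitE, hφ]
  rfl

/-- **Finite-level equivariance** (Neukirch IV (5.8) right-hand square, inside the Weil datum of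
`F` via `recMap_conjSub`): if `(x, L'/E) = w|_{L'}` then `(γ x, φ_ρ L'/E) = (ρ w ρ⁻¹)|_{φ_ρ L'}`.
[cite: NeukirchANT1999, Ch. IV Prop. (5.8)] -/
theorem recSystemE_semilinearImage (hcf : (localWeilDatum F).IsClassFieldTheory) (ρ : WeilGroup F)
    {φ : AlgebraicClosure E ≃+* AlgebraicClosure E}
    (hφι : ∀ a, φ (absClosureEmbedding F E a) = absClosureEmbedding F E (WeilGroup.toAbsGalois F ρ • a))
    {γ : E ≃+* E}
    (hφ : ∀ x : E, φ (algebraMap E (AlgebraicClosure E) x) = algebraMap E (AlgebraicClosure E) (γ x))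
    {L' M : IntermediateField E (AlgebraicClosure E)} (hM : ∀ z, z ∈ M ↔ φ.symm z ∈ L')
    [FiniteDimensional E L'] [IsAbelianGalois E L'] [FiniteDimensional E M] [IsAbelianGalois E M]
    (x : Eˣ) (w : fieldSubgroup F (embField F E))
    (h : recSystemE hcf L' x = weilRestrictE F E L' w) :
    recSystemE hcf M (Units.map (γ : E →* E) x) =
      weilRestrictE F E M ⟨ρ * w * ρ⁻¹, conj_mem_fieldSubgroup_embField F E ρ w⟩ := by
  set d := localWeilDatum F
  have hab := isAbelianPair_embField F E L'
  rw [recSystemE_eq_weilRestrictE_iff] at h ⊢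
  have hconj := hcf.recMap_conjSub hab.isField_left hab.isField_right hab.le hab.le_normalizer w.2 ρ
  rw [h, QuotientGroup.map_mk, MulDistribMulAction.toMonoidHom_apply, smul_unitE ρ hφι hφ] at hconj
  have key : ∀ U₁ V₁ : Subgroup (WeilGroup F), U₁ = conjSub ρ (fieldSubgroup F (embField F E)) →
      V₁ = conjSub ρ (fieldSubgroup F (embFieldOf F E L')) →
      d.recMap U₁ V₁ (ρ * w * ρ⁻¹) = QuotientGroup.mk (unitE F E (Units.map (γ : E →* E) x)) := by
    rintro _ _ rfl rfl
    exact hconj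
  exact key _ _ (conjSub_fieldSubgroup_embField F E ρ).symm
    (fieldSubgroup_embFieldOf_semilinearImage ρ hφι hM)

end Datum

end LocalWeilDatum

end Literature.NumberTheory.GaloisRepresentations
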